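import Mathlib
import HarnessLib
import Summits.Ventures.LatticeQCDFlow.Exactness.LatticeCoveringPullback
import Summits.Ventures.LatticeQCDFlow.Exactness.SU2MultiStepLeapfrogHMC

/-!
# The exact Pauli-drift force of an action under lattice translations and under coverings: `∂_{u@q} S̃(exp(a)·(V·t))|₀ = ∂_{u@(q+t)} S̃(exp(a)·V)|₀`, and the COVERING IDENTITY `∂_{u@e'} S̃'(exp(a')·(V∘σ̂))|₀ = ∂_{u@σ̂e'} S̃(exp(a)·V)|₀` for any pair of actions with `S̃'(W∘σ̂) = N·S̃(W)`

HONEST FRAMING: exact (Metropolis-corrected) sampling algorithms for lattice gauge theory;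
figures of merit are autocorrelation/cost numbers at stated couplings and volumes; no
continuum-physics claim.

Venture `LatticeQCDFlow` (cell pub-lqcd), topic `Exactness`; FANOUT row 14 (`eng-flowhmc`, engine
`latflow.fthmc`, family B: FT-HMC on `SU(2)`, forces by autodiff of a pulled-back action `S̃` along row
9's Pauli drift `U_l ← expPauli(a_l)·U_l` of `su2LeapfrogHMCN`).  NEW WORK of the cell over the tree
(`LatticeCoveringPullback`: site maps `σ x = (φ xᵢ)ᵢ`, fibres of cardinality `N`; the Literature's
`expPauli`) and Mathlib (`ContinuousLinearEquiv.comp_right_fderiv`, `fderiv_comp`,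
`fderiv_const_smul_field`); nothing is cited as a fact; no number.  Third file of the VOLUME-UNIFORMITY
chain (GEN-15); everything here is for an ABSTRACT action `S̃ : GaugeConfig d L SU(2) → ℝ` (the member
enters in `SU2ExactForceCovering`).  The force component at edge `q` in direction `u ∈ ℝ³` is Mathlib's
`fderiv ℝ (a ↦ S̃((l ↦ expPauli (a l)) · V)) 0 (Pi.single q u)` (the letters of GEN-14's
`SU2WilsonFlowLOExactForceRegular`).

THE POINT of §2.  Pull the momenta back too, `(Λa)(e') = a(σ̂ e')`: `exp(Λa)·(V∘σ̂) = (exp(a)·V)∘σ̂`, so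
`S̃'(exp(Λa)·(V∘σ̂)) = N·S̃(exp(a)·V)` identically in `a`; differentiate at `0` (chain rule — `S̃'` must be
differentiable there) and feed `u@l`, `l = σ̂ e'`: `Λ(u@l) = Σ_{e'' ∈ σ̂⁻¹ l} u@e''` is a sum over the `N`
lifts, and by translation covariance under the deck translations `t ∈ ker σ` (which fix `V∘σ̂`) every
lift contributes `∂_{u@e'} S̃'`; cancel `N ≠ 0`.

* §1 translations (any torus, any translation-invariant `S̃`): `pauliDrift_translate_mul`,
  `ftAction_pauliDrift_translate`, `single_pauli_translate`, **`su2PauliExactForce_translate`** (no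
  differentiability needed — the Pauli twin of `SU2ExactForceTranslationCovariance.su2ExactForce_translate`);
* §2 coverings: `pauliDrift_pull`, `pull_translate_of_ker` (deck translations fix pull-backs),
  `card_fibre_edgeMap`, `card_fibre_siteMap_pos`, **`su2PauliExactForce_pull`** (`φ` onto,
  `S̃'(W∘σ̂) = N·S̃(W)`, `S̃'` deck-invariant and differentiable along the drift at `V∘σ̂`).

NOT CLAIMED: fields upstairs that are not pull-backs; any number.
-/

noncomputable section

namespace Summit.Ventures.LatticeQCDFlow.Exactness

open Real Set MeasureTheory InnerProductGeometry WithLp NormedSpace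
open Literature.MathematicalPhysics.QuantumFieldTheory
open Literature.MathematicalPhysics.QuantumFieldTheory.Balaban1983to89.B10Eq18SigmaSU2Haar (expPauli)
open scoped Matrix Matrix.Norms.Operator

set_option backward.isDefEq.respectTransparency false

/-! ## §1 The Pauli drift under lattice translations -/

section Translate

variable {d L : ℕ}

/-- `exp(a)·(V·t) = (exp(a·(−t))·V)·t` — the Pauli drift seen from translated data. -/
theorem pauliDrift_translate_mul (t : Site d L) (a : Edge d L → EuclideanSpace ℝ (Fin 3))
    (V : GaugeConfig d L (Matrix.specialUnitaryGroup (Fin 2) ℂ)) :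
    ((fun l : Edge d L => expPauli (a l)) * (fun e : Edge d L => V (e.1 + t, e.2))) =
      fun e : Edge d L => (((fun l : Edge d L => expPauli ((fun q : Edge d L => a (q.1 - t, q.2)) l)) * V) :
        GaugeConfig d L (Matrix.specialUnitaryGroup (Fin 2) ℂ)) (e.1 + t, e.2) := by
  funext e
  simp only [Pi.mul_apply, add_sub_cancel_right, Prod.mk.eta]

/-- For a translation-invariant `S̃`, the action along the Pauli drift from `V·t` is the action along the
drift from `V` precomposed with the momentum re-indexing `a ↦ a·(−t)`. -/
theorem ftAction_pauliDrift_translate (t : Site d L)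
    {St : GaugeConfig d L (Matrix.specialUnitaryGroup (Fin 2) ℂ) → ℝ}
    (hSt : ∀ V : GaugeConfig d L (Matrix.specialUnitaryGroup (Fin 2) ℂ), St (fun e : Edge d L => V (e.1 + t, e.2)) = St V)
    (V : GaugeConfig d L (Matrix.specialUnitaryGroup (Fin 2) ℂ)) :
    (fun a : Edge d L → EuclideanSpace ℝ (Fin 3) => St ((fun l : Edge d L => expPauli (a l)) * (fun e : Edge d L => V (e.1 + t, e.2)))) =
      (fun a : Edge d L → EuclideanSpace ℝ (Fin 3) => St ((fun l : Edge d L => expPauli (a l)) * V)) ∘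
        (fun a : Edge d L → EuclideanSpace ℝ (Fin 3) => fun q : Edge d L => a (q.1 - t, q.2)) := by
  funext a
  rw [Function.comp_apply, pauliDrift_translate_mul t a V]
  exact hSt _

/-- The momentum re-indexing sends the coordinate vector `u@q` to `u@(q + t)`. -/
theorem single_pauli_translate (t : Site d L) (q : Edge d L) (u : EuclideanSpace ℝ (Fin 3)) :
    (fun i : Edge d L => (Pi.single q u : Edge d L → EuclideanSpace ℝ (Fin 3)) (i.1 - t, i.2)) =
      (Pi.single (q.1 + t, q.2) u : Edge d L → EuclideanSpace ℝ (Fin 3)) := by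
  funext i
  by_cases h : i = (q.1 + t, q.2)
  · subst h
    simp only [add_sub_cancel_right, Prod.mk.eta, Pi.single_eq_same]
  · rw [Pi.single_eq_of_ne h, Pi.single_eq_of_ne]
    intro h'
    apply h
    obtain ⟨x, μ⟩ := i
    obtain ⟨y, ν⟩ := q
    simp only [Prod.mk.injEq] at h' ⊢
    obtain ⟨hx, hμ⟩ := h'
    exact ⟨by rw [← hx, sub_add_cancel], hμ⟩

variable [NeZero L]

/-- **The exact Pauli-drift force of a translation-invariant action is translation covariant**:
`∂_{u@q} S̃(exp(a)·(V·t))|_{a=0} = ∂_{u@(q+t)} S̃(exp(a)·V)|_{a=0}` (chain rule through the continuous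
linear equivalence `a ↦ a·(−t)`; no differentiability hypothesis). -/
theorem su2PauliExactForce_translate (t : Site d L)
    {St : GaugeConfig d L (Matrix.specialUnitaryGroup (Fin 2) ℂ) → ℝ}
    (hSt : ∀ V : GaugeConfig d L (Matrix.specialUnitaryGroup (Fin 2) ℂ), St (fun e : Edge d L => V (e.1 + t, e.2)) = St V)
    (V : GaugeConfig d L (Matrix.specialUnitaryGroup (Fin 2) ℂ)) (q : Edge d L) (u : EuclideanSpace ℝ (Fin 3)) :
    fderiv ℝ (fun a : Edge d L → EuclideanSpace ℝ (Fin 3) => St ((fun l : Edge d L => expPauli (a l)) * (fun e : Edge d L => V (e.1 + t, e.2)))) 0 (Pi.single q u) =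
      fderiv ℝ (fun a : Edge d L → EuclideanSpace ℝ (Fin 3) => St ((fun l : Edge d L => expPauli (a l)) * V)) 0 (Pi.single (q.1 + t, q.2) u) := by
  let Le : (Edge d L → EuclideanSpace ℝ (Fin 3)) ≃ₗ[ℝ] (Edge d L → EuclideanSpace ℝ (Fin 3)) :=
    { toFun := fun a => fun q : Edge d L => a (q.1 - t, q.2),
      invFun := fun a => fun q : Edge d L => a (q.1 + t, q.2),
      map_add' := fun a a' => rfl,
      map_smul' := fun r a => rfl,
      left_inv := fun a => funext fun q => by simp only [add_sub_cancel_right, Prod.mk.eta],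
      right_inv := fun a => funext fun q => by simp only [sub_add_cancel, Prod.mk.eta] }
  let Lc : (Edge d L → EuclideanSpace ℝ (Fin 3)) ≃L[ℝ] (Edge d L → EuclideanSpace ℝ (Fin 3)) :=
    Le.toContinuousLinearEquiv
  have hLc : (fun a : Edge d L → EuclideanSpace ℝ (Fin 3) => fun q : Edge d L => a (q.1 - t, q.2)) = ⇑Lc := rfl
  rw [ftAction_pauliDrift_translate t hSt V, hLc, Lc.comp_right_fderiv, ContinuousLinearEquiv.map_zero,
    ContinuousLinearMap.comp_apply]
  change fderiv ℝ (fun a : Edge d L → EuclideanSpace ℝ (Fin 3) => St ((fun l : Edge d L => expPauli (a l)) * V)) 0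
      (fun i : Edge d L => (Pi.single q u : Edge d L → EuclideanSpace ℝ (Fin 3)) (i.1 - t, i.2)) = _
  rw [single_pauli_translate t q u]

end Translate

/-! ## §2 The covering identity for the exact Pauli-drift force of an abstract pair of actions -/

section Pull

variable {d L L' : ℕ} (φ : ZMod L' →+* ZMod L)

/-- **The Pauli drift commutes with pull-back**: `exp(Λa)·(V∘σ̂) = (exp(a)·V)∘σ̂` for the pulled-back
momenta `(Λa)(e') = a(σ̂ e')`. -/
theorem pauliDrift_pull (a : Edge d L → EuclideanSpace ℝ (Fin 3))
    (V : GaugeConfig d L (Matrix.specialUnitaryGroup (Fin 2) ℂ)) :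
    ((fun l : Edge d L' => expPauli (a ((fun j => φ (l.1 j)), l.2))) * (fun e : Edge d L' => V (fun i => φ (e.1 i), e.2))) =
      fun e : Edge d L' => (((fun l : Edge d L => expPauli (a l)) * V) : GaugeConfig d L (Matrix.specialUnitaryGroup (Fin 2) ℂ))
        ((fun j => φ (e.1 j)), e.2) := by
  funext e
  simp only [Pi.mul_apply]

/-- **Deck translations fix pulled-back fields**: if `σ t = 0` then `(W∘σ̂)·t = W∘σ̂`. -/
theorem pull_translate_of_ker {t : Site d L'} (ht : (fun j => φ (t j)) = 0) {α : Type*} (W : Edge d L → α) :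
    (fun e : Edge d L' => ((fun e : Edge d L' => W (fun i => φ (e.1 i), e.2)) : Edge d L' → α) (e.1 + t, e.2)) =
      (fun e : Edge d L' => W (fun i => φ (e.1 i), e.2)) := by
  funext e
  have h : (fun j => φ ((e.1 + t) j)) = fun j => φ (e.1 j) := by
    funext j
    have hj : φ (t j) = 0 := congrFun ht j
    simp only [Pi.add_apply, map_add, hj, add_zero]
  simp only [h]

variable [NeZero L] [NeZero L']

omit [NeZero L] in
/-- The fibre of the edge map `σ̂` over an edge has `N` elements. -/
theorem card_fibre_edgeMap (hφ : Function.Surjective φ) (l : Edge d L) :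
    (Finset.univ.filter (fun e : Edge d L' => ((fun j => φ (e.1 j)), e.2) = l)).card =
      Fintype.card {x : Site d L' // (fun j => φ (x j)) = 0} := by
  rw [← card_fibre_siteMap φ hφ l.1, Fintype.card_subtype]
  refine Finset.card_bij (fun e _ => e.1) (fun e he => ?_) (fun e he e'' he'' h => ?_) (fun x hx => ?_)
  · simp only [Finset.mem_filter, Finset.mem_univ, true_and] at he ⊢
    exact congrArg Prod.fst he
  · simp only [Finset.mem_filter, Finset.mem_univ, true_and] at he he''
    exact Prod.ext h ((congrArg Prod.snd he).trans (congrArg Prod.snd he'').symm)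
  · simp only [Finset.mem_filter, Finset.mem_univ, true_and] at hx
    exact ⟨(x, l.2), by simp only [Finset.mem_filter, Finset.mem_univ, true_and, hx, Prod.mk.eta], rfl⟩

omit [NeZero L] in
/-- `N ≥ 1` (the zero site lies over zero). -/
theorem card_fibre_siteMap_pos : 0 < Fintype.card {x : Site d L' // (fun j => φ (x j)) = 0} :=
  Fintype.card_pos_iff.2 ⟨⟨0, funext fun j => by simp only [Pi.zero_apply, map_zero]⟩⟩

/-- **THE COVERING IDENTITY FOR THE EXACT PAULI-DRIFT FORCE (abstract pair of actions).**  `φ` onto,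
`S̃` on the `L`-torus and `S̃'` on the `L'`-torus with `S̃'(W∘σ̂) = N·S̃(W)` for all `W`, `S̃'` invariant
under every deck translation `t` (`σ t = 0`), and `a' ↦ S̃'(exp(a')·(V∘σ̂))` differentiable at `0`: then
for every edge `e'` upstairs and every `u ∈ ℝ³`,
`∂_{u@e'} S̃'(exp(a')·(V∘σ̂))|₀ = ∂_{u@σ̂e'} S̃(exp(a)·V)|₀`. -/
theorem su2PauliExactForce_pull (hφ : Function.Surjective φ)
    {St : GaugeConfig d L (Matrix.specialUnitaryGroup (Fin 2) ℂ) → ℝ}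
    {St' : GaugeConfig d L' (Matrix.specialUnitaryGroup (Fin 2) ℂ) → ℝ}
    (hSt : ∀ W : GaugeConfig d L (Matrix.specialUnitaryGroup (Fin 2) ℂ),
      St' (fun e : Edge d L' => W (fun i => φ (e.1 i), e.2)) = (Fintype.card {x : Site d L' // (fun j => φ (x j)) = 0} : ℝ) * St W)
    (hinv : ∀ t : Site d L', (fun j => φ (t j)) = 0 →
      ∀ W : GaugeConfig d L' (Matrix.specialUnitaryGroup (Fin 2) ℂ), St' (fun e : Edge d L' => W (e.1 + t, e.2)) = St' W)
    (V : GaugeConfig d L (Matrix.specialUnitaryGroup (Fin 2) ℂ))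
    (hdiff : DifferentiableAt ℝ (fun a : Edge d L' → EuclideanSpace ℝ (Fin 3) => St' ((fun l : Edge d L' => expPauli (a l)) * (fun e : Edge d L' => V (fun i => φ (e.1 i), e.2)))) 0)
    (e' : Edge d L') (u : EuclideanSpace ℝ (Fin 3)) :
    fderiv ℝ (fun a : Edge d L' → EuclideanSpace ℝ (Fin 3) => St' ((fun l : Edge d L' => expPauli (a l)) * (fun e : Edge d L' => V (fun i => φ (e.1 i), e.2)))) 0 (Pi.single e' u) =
      fderiv ℝ (fun a : Edge d L → EuclideanSpace ℝ (Fin 3) => St ((fun l : Edge d L => expPauli (a l)) * V)) 0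
        (Pi.single ((fun j => φ (e'.1 j)), e'.2) u) := by
  -- the pull-back of momenta, a continuous linear map
  let Λ : (Edge d L → EuclideanSpace ℝ (Fin 3)) →L[ℝ] (Edge d L' → EuclideanSpace ℝ (Fin 3)) :=
    LinearMap.toContinuousLinearMap
      { toFun := fun a => fun e : Edge d L' => a ((fun j => φ (e.1 j)), e.2),
        map_add' := fun a b => rfl,
        map_smul' := fun r a => rfl }
  have hΛ : ∀ a : Edge d L → EuclideanSpace ℝ (Fin 3), Λ a = fun e : Edge d L' => a ((fun j => φ (e.1 j)), e.2) :=
    fun a => rfl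
  -- (1) upstairs action of pulled-back momenta = N • downstairs action
  have hcomp : (fun a : Edge d L' → EuclideanSpace ℝ (Fin 3) => St' ((fun l : Edge d L' => expPauli (a l)) * (fun e : Edge d L' => V (fun i => φ (e.1 i), e.2)))) ∘ ⇑Λ =
      (Fintype.card {x : Site d L' // (fun j => φ (x j)) = 0} : ℝ) •
        (fun a : Edge d L → EuclideanSpace ℝ (Fin 3) => St ((fun l : Edge d L => expPauli (a l)) * V)) := by
    funext a
    simp only [Function.comp_apply, hΛ]
    rw [pauliDrift_pull φ a V, hSt, Pi.smul_apply, smul_eq_mul]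
  -- (2) the chain rule at `a = 0`
  have hΛ0 : Λ 0 = 0 := map_zero Λ
  have hd0 : DifferentiableAt ℝ (fun a : Edge d L' → EuclideanSpace ℝ (Fin 3) => St' ((fun l : Edge d L' => expPauli (a l)) * (fun e : Edge d L' => V (fun i => φ (e.1 i), e.2)))) (Λ 0) := by
    rw [hΛ0]
    exact hdiff
  have hchain : (fderiv ℝ (fun a : Edge d L' → EuclideanSpace ℝ (Fin 3) => St' ((fun l : Edge d L' => expPauli (a l)) * (fun e : Edge d L' => V (fun i => φ (e.1 i), e.2)))) 0).comp Λ =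
      (Fintype.card {x : Site d L' // (fun j => φ (x j)) = 0} : ℝ) •
        fderiv ℝ (fun a : Edge d L → EuclideanSpace ℝ (Fin 3) => St ((fun l : Edge d L => expPauli (a l)) * V)) 0 := by
    have h := fderiv_comp (0 : Edge d L → EuclideanSpace ℝ (Fin 3)) hd0 Λ.differentiableAt
    rw [hcomp, Λ.fderiv, hΛ0, fderiv_const_smul_field] at h
    rw [← h, Pi.smul_apply]
  -- (3) apply to the coordinate vector `u` at `l = σ̂ e'`: the pulled-back vector is the sum over the fibre
  have happ := congrArg (fun T : (Edge d L → EuclideanSpace ℝ (Fin 3)) →L[ℝ] ℝ =>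
    T (Pi.single ((fun j => φ (e'.1 j)), e'.2) u)) hchain
  simp only [ContinuousLinearMap.comp_apply, FunLike.coe_smul, Pi.smul_apply, smul_eq_mul] at happ
  have hfib : Λ (Pi.single ((fun j => φ (e'.1 j)), e'.2) u) =
      ∑ e'' ∈ Finset.univ.filter (fun e'' : Edge d L' => ((fun j => φ (e''.1 j)), e''.2) = ((fun j => φ (e'.1 j)), e'.2)),
        (Pi.single e'' u : Edge d L' → EuclideanSpace ℝ (Fin 3)) := by
    rw [hΛ]
    funext i
    rw [Finset.sum_apply]
    simp only [Pi.single_apply]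
    rw [Finset.sum_ite_eq]
    simp only [Finset.mem_filter, Finset.mem_univ, true_and]
  rw [hfib, map_sum] at happ
  -- (4) every lift contributes the same number (deck translations)
  have hterm : ∀ e'' ∈ Finset.univ.filter (fun e'' : Edge d L' => ((fun j => φ (e''.1 j)), e''.2) = ((fun j => φ (e'.1 j)), e'.2)),
      fderiv ℝ (fun a : Edge d L' → EuclideanSpace ℝ (Fin 3) => St' ((fun l : Edge d L' => expPauli (a l)) * (fun e : Edge d L' => V (fun i => φ (e.1 i), e.2)))) 0 (Pi.single e'' u) =
        fderiv ℝ (fun a : Edge d L' → EuclideanSpace ℝ (Fin 3) => St' ((fun l : Edge d L' => expPauli (a l)) * (fun e : Edge d L' => V (fun i => φ (e.1 i), e.2)))) 0 (Pi.single e' u) := by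
    intro e'' he''
    simp only [Finset.mem_filter, Finset.mem_univ, true_and, Prod.mk.injEq] at he''
    obtain ⟨h1, h2⟩ := he''
    have ht : (fun j => φ ((e''.1 - e'.1) j)) = 0 := by
      funext j
      have hj : φ (e''.1 j) = φ (e'.1 j) := congrFun h1 j
      simp only [Pi.sub_apply, map_sub, hj, sub_self, Pi.zero_apply]
    set W : GaugeConfig d L' (Matrix.specialUnitaryGroup (Fin 2) ℂ) := (fun e : Edge d L' => V (fun i => φ (e.1 i), e.2)) with hW
    have hWt : (fun e : Edge d L' => W (e.1 + (e''.1 - e'.1), e.2)) = W := by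
      rw [hW]
      exact pull_translate_of_ker φ ht V
    have key := su2PauliExactForce_translate (e''.1 - e'.1) (hinv (e''.1 - e'.1) ht) W e' u
    rw [hWt] at key
    rw [key, add_sub_cancel, ← h2, Prod.mk.eta]
  rw [Finset.sum_congr rfl hterm, Finset.sum_const, card_fibre_edgeMap φ hφ, nsmul_eq_mul] at happ
  -- (5) cancel `N ≠ 0`
  exact mul_left_cancel₀ (Nat.cast_ne_zero.2 (card_fibre_siteMap_pos φ).ne') happ

end Pull

end Summit.Ventures.LatticeQCDFlow.Exactness
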